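import Summits.ValiantsHypothesis.ValiantsHypothesis.Theorems.FeketeSOSFeketeSOSHardPaleyRIPPairing
import Summits.ValiantsHypothesis.ValiantsHypothesis.Theorems.FeketeSOSFeketeSOSHardGoodReductionTransfer

/-!
# Route FeketeSOS — crux `FeketeSOSHard` (stmt-ValiantsHypothesis-3996), line `paley-rip` (skeleton v3):
# `stub_tameOperator` by ℓ¹-SPREADING — every rank, bound `#(S+S mod p)·M` (small-doubling supports are tame)

Certificate P2 of the census (`Cruxes/FeketeSOSHard/Lines/paley-rip-stub3-census.md` §4) in kernel form.  Let
`(c_i, w_i)_{i<r}` be weighted squares supported in `S ⊆ [0,p)` with cyclic pattern `F` (`deg F < p`,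
`X^p − 1 ∣ Σ c_i w_i² − F`, `|F_n| ≤ M`).  The pattern lives on the sumset: `F_ν = 0` unless `ν ∈ S + S (mod p)`
(`coeff_pattern_eq_zero`, from the dual pairing `pairing_of_dvd` of `…PaleyRIPPairing.lean` with an indicator
weight).  Choosing one representation `ν ≡ s_ν + t_ν` per sum and writing each monomial as two 2-sparse squares,
`F_ν X^{s_ν} X^{t_ν} = (F_ν/4)(X^{s_ν} + X^{t_ν})² − (F_ν/4)(X^{s_ν} − X^{t_ν})²` (mass exactly `|F_ν|`, also when
`s_ν = t_ν`), gives squares supported in `S` with the same cyclic pattern and total mass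
`≤ Σ_{ν ∈ S+S} |F_ν| ≤ #(S+S mod p) · M` (`tameOperator_spread`).  Consequences: `stub_tameOperator` holds with
exponent `2` for every rank (`#(S+S) ≤ #S²`, `tameOperator_spread_sq`), and with exponent `1` on every support of
doubling `#(S+S) ≤ K·#S` (intervals, arithmetic progressions, …).  With `…PaleyRIPRankTwoSidon.lean` (Sidon
supports, `r = 2`, exponent 1) the open content of the stub at rank 2 is confined to supports of INTERMEDIATE
additive structure.

Honest framing: `stub_tameOperator` (exponent `1+ε`, all ranks), the engine and the crux stay OPEN; `VP ≠ VNP`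
untouched.
-/

set_option linter.dupNamespace false

namespace Summit.ValiantsHypothesis.ValiantsHypothesis.Theorems.FeketeSOSHardPaleyRIP

open Polynomial Finset
open scoped BigOperators

noncomputable section

section Spread

variable (p : ℕ) [Fact p.Prime]

/-- The pattern of squares supported in `S` vanishes off the sumset `S + S (mod p)`. [folklore] -/
theorem coeff_pattern_eq_zero (S : Finset ℕ) (r : ℕ) (c : Fin r → ℂ) (w : Fin r → ℂ[X])
    (hw : ∀ i, (w i).support ⊆ S) (F : ℂ[X]) (hF : F.natDegree < p)
    (hdvd : (X : ℂ[X]) ^ p - 1 ∣ (∑ i, C (c i) * w i ^ 2) - F) (ν : ZMod p)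
    (hν : ν ∉ (S ×ˢ S).image (fun st : ℕ × ℕ => ((st.1 + st.2 : ℕ) : ZMod p))) :
    F.coeff ν.val = 0 := by
  classical
  have h := pairing_of_dvd p (fun m => if m = ν then 1 else 0) r c w F hF hdvd
  have hl : ∑ m ∈ range p, (if ((m : ℕ) : ZMod p) = ν then (1 : ℂ) else 0) * F.coeff m = F.coeff ν.val := by
    rw [Finset.sum_eq_single ν.val]
    · simp
    · intro m hm hne
      have : ((m : ℕ) : ZMod p) ≠ ν := by
        intro hmn; apply hne
        rw [← hmn, ZMod.val_natCast, Nat.mod_eq_of_lt (mem_range.1 hm)]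
      simp [this]
    · intro hn; exact absurd (mem_range.2 (ZMod.val_lt ν)) hn
  rw [hl] at h
  rw [h]
  refine Finset.sum_eq_zero fun i _ => ?_
  rw [Finset.sum_eq_zero fun a ha => ?_, mul_zero]
  refine Finset.sum_eq_zero fun b hb => ?_
  have hab : ((a + b : ℕ) : ZMod p) ≠ ν := by
    intro h'
    exact hν (Finset.mem_image.2 ⟨(a, b), Finset.mem_product.2 ⟨hw i ha, hw i hb⟩, h'⟩)
  rw [if_neg hab, zero_mul, zero_mul]

/-- A polynomial of degree `< p` as a sum over the residues mod `p`. [folklore] -/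
theorem eq_sum_zmod (F : ℂ[X]) (hF : F.natDegree < p) :
    F = ∑ ν : ZMod p, C (F.coeff ν.val) * X ^ ν.val := by
  classical
  have hp : NeZero p := ⟨(Fact.out : p.Prime).ne_zero⟩
  have h1 : F = ∑ n ∈ range p, C (F.coeff n) * X ^ n := by
    conv_lhs => rw [as_sum_range' F p hF]
    simp_rw [C_mul_X_pow_eq_monomial]
  conv_lhs => rw [h1]
  refine Finset.sum_nbij' (fun n => ((n : ℕ) : ZMod p)) (fun ν => ν.val) (fun _ _ => Finset.mem_univ _)
    (fun ν _ => mem_range.2 (ZMod.val_lt ν)) (fun n hn => ?_) (fun ν _ => ZMod.natCast_zmod_val ν)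
    (fun n hn => ?_)
  · rw [ZMod.val_natCast, Nat.mod_eq_of_lt (mem_range.1 hn)]
  · rw [ZMod.val_natCast, Nat.mod_eq_of_lt (mem_range.1 hn)]

/-- The quarter-squares identity with weights: `(F/4)(U+V)² + (−F/4)(U−V)² = F·U·V`. [folklore] -/
theorem quarter_squares (f : ℂ) (U V : ℂ[X]) :
    C (f / 4) * (U + V) ^ 2 + C (-(f / 4)) * (U - V) ^ 2 = C f * (U * V) := by
  have h4 : C (f / 4) = C f * C ((4 : ℂ)⁻¹) := by rw [← map_mul, div_eq_mul_inv]
  have hq : (4 : ℂ[X]) * C ((4 : ℂ)⁻¹) = 1 := by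
    rw [show (4 : ℂ[X]) = C (4 : ℂ) from (map_ofNat C 4).symm, ← map_mul,
      mul_inv_cancel₀ (by norm_num : (4 : ℂ) ≠ 0), map_one]
  rw [map_neg, h4]
  linear_combination (C f * (U * V)) * hq

/-- The quarter-squares identity in the binomial normal form used below. [folklore] -/
theorem quarter_squares' (f : ℂ) (s t : ℕ) :
    C (f / 4) * (C 1 * X ^ s + C 1 * X ^ t) ^ 2 + C (-(f / 4)) * (C 1 * X ^ s + C (-1) * X ^ t) ^ 2 =
      C f * (X ^ s * X ^ t) := by
  have h := quarter_squares f (X ^ s) (X ^ t)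
  have e1 : (C (1 : ℂ) * X ^ s + C 1 * X ^ t : ℂ[X]) = X ^ s + X ^ t := by rw [map_one, one_mul, one_mul]
  have e2 : (C (1 : ℂ) * X ^ s + C (-1) * X ^ t : ℂ[X]) = X ^ s - X ^ t := by
    rw [map_neg, map_one, one_mul, neg_one_mul, sub_eq_add_neg]
  rw [e1, e2]; exact h

/-- Mass of the two 2-sparse squares carrying one monomial: for `s, t ∈ ℕ` and `f ∈ ℂ`,
`sqMass (f/4) (X^s + X^t) + sqMass (−f/4) (X^s − X^t) ≤ |f|` (equality in fact; also when `s = t`). [folklore] -/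
theorem sqMass_pair_monomial_le (f : ℂ) (s t : ℕ) :
    sqMass (f / 4) (C 1 * X ^ s + C 1 * X ^ t) + sqMass (-(f / 4)) (C 1 * X ^ s + C (-1) * X ^ t) ≤ ‖f‖ := by
  classical
  unfold sqMass
  rw [norm_neg, norm_div, show ‖(4 : ℂ)‖ = 4 by simp]
  have hsub1 : (C (1 : ℂ) * X ^ s + C 1 * X ^ t).support ⊆ {s, t} := support_binomial_subset s t _ _
  have hsub2 : (C (1 : ℂ) * X ^ s + C (-1) * X ^ t).support ⊆ {s, t} := support_binomial_subset s t _ _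
  have h1 := Finset.sum_le_sum_of_subset_of_nonneg hsub1
    (f := fun a => ‖(C (1 : ℂ) * X ^ s + C 1 * X ^ t).coeff a‖ ^ 2) fun _ _ _ => sq_nonneg _
  have h2 := Finset.sum_le_sum_of_subset_of_nonneg hsub2
    (f := fun a => ‖(C (1 : ℂ) * X ^ s + C (-1) * X ^ t).coeff a‖ ^ 2) fun _ _ _ => sq_nonneg _
  have htot : ∑ a ∈ ({s, t} : Finset ℕ), ‖(C (1 : ℂ) * X ^ s + C 1 * X ^ t).coeff a‖ ^ 2 +
      ∑ a ∈ ({s, t} : Finset ℕ), ‖(C (1 : ℂ) * X ^ s + C (-1) * X ^ t).coeff a‖ ^ 2 = 4 := by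
    by_cases hst : s = t
    · subst hst
      rw [Finset.insert_eq_of_mem (Finset.mem_singleton_self s), Finset.sum_singleton, Finset.sum_singleton]
      simp only [coeff_add, coeff_C_mul_X_pow, if_true]
      norm_num
    · rw [Finset.sum_pair hst, Finset.sum_pair hst]
      simp only [coeff_add, coeff_C_mul_X_pow, if_true, if_neg hst, if_neg (Ne.symm hst)]
      norm_num
  have hf0 : 0 ≤ ‖f‖ / 4 := by positivity
  nlinarith [h1, h2, htot, mul_le_mul_of_nonneg_left h1 hf0, mul_le_mul_of_nonneg_left h2 hf0]

/-- **`stub_tameOperator` by ℓ¹-spreading (every rank; bound `#(S+S mod p)·M`).**  Weighted squares supported in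
`S` whose cyclic pattern `F` has coefficients of modulus `≤ M` can be replaced by 2-sparse squares supported in
`S` with the same pattern and total mass `≤ #(S + S mod p) · M` (no hypothesis `S ⊆ [0,p)` is needed). [folklore] -/
theorem tameOperator_spread (S : Finset ℕ) (r : ℕ) (c : Fin r → ℂ) (w : Fin r → ℂ[X])
    (hw : ∀ i, (w i).support ⊆ S) (F : ℂ[X]) (M : ℝ) (hF : F.natDegree < p)
    (hdvd : (X : ℂ[X]) ^ p - 1 ∣ (∑ i, C (c i) * w i ^ 2) - F) (hM : ∀ n, ‖F.coeff n‖ ≤ M) :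
    ∃ (s' : ℕ) (c' : Fin s' → ℂ) (w' : Fin s' → ℂ[X]), (∀ j, (w' j).support ⊆ S) ∧
      ((X : ℂ[X]) ^ p - 1 ∣ (∑ j, C (c' j) * w' j ^ 2) - F) ∧
      (∑ j, sqMass (c' j) (w' j)) ≤
        (((S ×ˢ S).image (fun st : ℕ × ℕ => ((st.1 + st.2 : ℕ) : ZMod p))).card : ℝ) * M := by
  classical
  have hM0 : 0 ≤ M := (norm_nonneg _).trans (hM 0)
  set T : Finset (ZMod p) := (S ×ˢ S).image (fun st : ℕ × ℕ => ((st.1 + st.2 : ℕ) : ZMod p)) with hTdef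
  -- one representation per sum
  have hrep : ∀ ν : T, ∃ st : ℕ × ℕ, st ∈ S ×ˢ S ∧ ((st.1 + st.2 : ℕ) : ZMod p) = ν.1 := fun ν => by
    obtain ⟨st, hst, h⟩ := Finset.mem_image.1 ν.2
    exact ⟨st, hst, h⟩
  choose rep hrepS hrepν using hrep
  have hs : ∀ ν : T, (rep ν).1 ∈ S := fun ν => (Finset.mem_product.1 (hrepS ν)).1
  have ht : ∀ ν : T, (rep ν).2 ∈ S := fun ν => (Finset.mem_product.1 (hrepS ν)).2
  -- the family, indexed by `T × Fin 2`
  let cc : T × Fin 2 → ℂ := fun q => (![F.coeff q.1.1.val / 4, -(F.coeff q.1.1.val / 4)] : Fin 2 → ℂ) q.2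
  let ww : T × Fin 2 → ℂ[X] := fun q =>
    (![C 1 * X ^ (rep q.1).1 + C 1 * X ^ (rep q.1).2, C 1 * X ^ (rep q.1).1 + C (-1) * X ^ (rep q.1).2] :
      Fin 2 → ℂ[X]) q.2
  have hwwS : ∀ q, (ww q).support ⊆ S := by
    rintro ⟨ν, k⟩
    have hpair : ({(rep ν).1, (rep ν).2} : Finset ℕ) ⊆ S :=
      Finset.insert_subset (hs ν) (Finset.singleton_subset_iff.2 (ht ν))
    fin_cases k
    · exact (support_binomial_subset _ _ _ _).trans hpair
    · exact (support_binomial_subset _ _ _ _).trans hpair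
  -- `F` as a sum over the residues in `T`
  have hFsum : F = ∑ ν : T, C (F.coeff ν.1.val) * X ^ ν.1.val := by
    conv_lhs => rw [eq_sum_zmod p F hF]
    rw [← Finset.sum_subset (Finset.subset_univ T) (fun ν _ hν => by
      rw [coeff_pattern_eq_zero p S r c w hw F hF hdvd ν hν, map_zero, zero_mul])]
    exact (Finset.sum_coe_sort T (fun ν => C (F.coeff ν.val) * X ^ ν.val)).symm
  -- the squares carry `Σ_ν F_ν X^{s_ν} X^{t_ν}`
  have hSQ : (∑ q : T × Fin 2, C (cc q) * ww q ^ 2) =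
      ∑ ν : T, C (F.coeff ν.1.val) * (X ^ (rep ν).1 * X ^ (rep ν).2) := by
    rw [Fintype.sum_prod_type]
    refine Finset.sum_congr rfl fun ν _ => ?_
    rw [Fin.sum_univ_two]
    exact quarter_squares' (F.coeff ν.1.val) (rep ν).1 (rep ν).2
  have hG : (X : ℂ[X]) ^ p - 1 ∣ (∑ ν : T, C (F.coeff ν.1.val) * (X ^ (rep ν).1 * X ^ (rep ν).2)) -
      ∑ ν : T, C (F.coeff ν.1.val) * X ^ ν.1.val := by
    rw [← Finset.sum_sub_distrib]
    refine Finset.dvd_sum fun ν _ => ?_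
    rw [← mul_sub, ← pow_add]
    refine Dvd.dvd.mul_left ?_ _
    have hval : ν.1.val = ((rep ν).1 + (rep ν).2) % p := by
      rw [← hrepν ν, ZMod.val_natCast]
    rw [hval, ← dvd_neg, neg_sub]
    exact FeketeSOSHardSketch.grt_X_pow_sub_one_dvd_X_pow_mod_sub p _
  have hGF : (X : ℂ[X]) ^ p - 1 ∣ (∑ ν : T, C (F.coeff ν.1.val) * X ^ ν.1.val) - F := by
    rw [← hFsum, sub_self]; exact dvd_zero _
  -- mass per sum
  have hmassq : (∑ q : T × Fin 2, sqMass (cc q) (ww q)) ≤ (T.card : ℝ) * M := by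
    rw [Fintype.sum_prod_type]
    calc ∑ ν : T, ∑ k : Fin 2, sqMass (cc (ν, k)) (ww (ν, k))
        ≤ ∑ ν : T, ‖F.coeff ν.1.val‖ := Finset.sum_le_sum fun ν _ => by
          rw [Fin.sum_univ_two]
          exact sqMass_pair_monomial_le (F.coeff ν.1.val) (rep ν).1 (rep ν).2
      _ ≤ ∑ ν : T, M := Finset.sum_le_sum fun ν _ => hM _
      _ = (T.card : ℝ) * M := by rw [Finset.sum_const, Finset.card_univ, Fintype.card_coe, nsmul_eq_mul]
  -- reindex by `Fin s'`
  let e := (Fintype.equivFin (T × Fin 2)).symm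
  refine ⟨Fintype.card (T × Fin 2), fun j => cc (e j), fun j => ww (e j), fun j => hwwS (e j), ?_, ?_⟩
  · rw [Fintype.sum_equiv e (fun j => C (cc (e j)) * ww (e j) ^ 2) (fun q => C (cc q) * ww q ^ 2)
      (fun j => rfl), hSQ]
    have := dvd_add hG hGF
    rwa [sub_add_sub_cancel] at this
  · rw [Fintype.sum_equiv e (fun j => sqMass (cc (e j)) (ww (e j))) (fun q => sqMass (cc q) (ww q))
      (fun j => rfl)]
    exact hmassq

/-- The same with the crude count `#(S+S mod p) ≤ #S²`: `stub_tameOperator` holds with exponent `2` for every rank. -/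
theorem tameOperator_spread_sq (S : Finset ℕ) (r : ℕ) (c : Fin r → ℂ)
    (w : Fin r → ℂ[X]) (hw : ∀ i, (w i).support ⊆ S) (F : ℂ[X]) (M : ℝ) (hF : F.natDegree < p)
    (hdvd : (X : ℂ[X]) ^ p - 1 ∣ (∑ i, C (c i) * w i ^ 2) - F) (hM : ∀ n, ‖F.coeff n‖ ≤ M) :
    ∃ (s' : ℕ) (c' : Fin s' → ℂ) (w' : Fin s' → ℂ[X]), (∀ j, (w' j).support ⊆ S) ∧
      ((X : ℂ[X]) ^ p - 1 ∣ (∑ j, C (c' j) * w' j ^ 2) - F) ∧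
      (∑ j, sqMass (c' j) (w' j)) ≤ (S.card : ℝ) ^ 2 * M := by
  classical
  have hM0 : 0 ≤ M := (norm_nonneg _).trans (hM 0)
  obtain ⟨s', c', w', h1, h2, h3⟩ := tameOperator_spread p S r c w hw F M hF hdvd hM
  refine ⟨s', c', w', h1, h2, h3.trans (mul_le_mul_of_nonneg_right ?_ hM0)⟩
  have := (Finset.card_image_le (s := S ×ˢ S) (f := fun st : ℕ × ℕ => ((st.1 + st.2 : ℕ) : ZMod p)))
  rw [Finset.card_product] at this
  exact_mod_cast (by nlinarith [this] : ((S ×ˢ S).image (fun st : ℕ × ℕ => ((st.1 + st.2 : ℕ) : ZMod p))).card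
    ≤ S.card ^ 2)

end Spread

end

end Summit.ValiantsHypothesis.ValiantsHypothesis.Theorems.FeketeSOSHardPaleyRIP
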